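import Summits.CriticalPhenomena.SAWScalingLimit.Theorems.SAWEdgeOfPositiveTypeInfiniteDivisibilityRefutation
import Literature.Probability.RandomPlanarGeometry.SAWBridgeRadius

/-!
# Route `SAWEdgeOfPositiveType`, item `ConvexMetricUpgrade` (stmt-CriticalPhenomena-13964), part 1:
# domain kernels and convex tubes

Helpers for the engine `ConvexMetricTriangle → AveragedTubeMass → TubeLowerBound`.  The critical polymer
kernel of a finite site set `T ⊆ ℤ²` is `IDRefutation.Zfun T x_c a b = Σ_{n<|T|} Σ_{ω : a → b, ω ⊆ T} x_c^n`
(literally the `let Z` of `ConvexMetricTriangle`; the definition is reused from the refutation file of the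
all-`Λ` umbrella).  Contents (all `theorem`s, no definitions):

* bookkeeping for `Zfun`: a confined self-avoiding walk has fewer steps than `|T|` (`lt_card_of_confined`),
  so every partial sum is `≤ Zfun` and `Zfun ≤` the partial sum to `N ≥ |T| - 1`; monotonicity in `T`;
  the endpoints of a positive kernel lie in `T`; one confined walk bounds the kernel below by `x_c^n`;
* `cmt_zfun` — `ConvexMetricTriangle` specialised to `x = x_c`;
* convex tubes: `K(u,v,ℓ) = cthickening (ℓ/10 + 2) [u, v]` is convex, membership is the distance test
  `infDist z [u,v] ≤ ℓ/10 + 2`, its lattice trace is finite (`exists_tube_trace`), contains `u` and `v`,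
  and NESTS: the trace of `K(w,v,ℓ')` lies in the trace of `K(u,v,ℓ)` when `|w − v| ≤ ℓ'`, `11 ℓ' ≤ ℓ`;
* `exists_ball_finset` — the lattice points of a ball of radius `R ≥ 1` form a `Finset` of size `≤ 9R²`.

## References

* C. Berg, J. P. R. Christensen, P. Ressel, *Harmonic Analysis on Semigroups* (1984), Ch. 3
  [BergChristensenRessel1984].
* N. Madras, G. Slade, *The Self-Avoiding Walk* (1993), §1.2 [MadrasSlade1993].
-/

noncomputable section

namespace Summit.CriticalPhenomena.SAWScalingLimit.Theorems.ConvexMetricUpgrade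

open scoped BigOperators Classical
open Literature.Probability.LatticeModels
open Literature.Probability.RandomPlanarGeometry Literature.Probability.RandomPlanarGeometry.SAW
open Summit.CriticalPhenomena.SAWScalingLimit.Theses.SAWEdgeOfPositiveType (ConvexMetricTriangle)
open Summit.CriticalPhenomena.SAWScalingLimit.Theorems.IDRefutation (Zfun)

/-! ### Domain kernels -/

/-- Unfolding of the reused kernel at `x = x_c`. [cite: MadrasSlade1993, §1.2] -/
theorem zfun_eq (T : Finset (Site 2)) (a b : Site 2) :
    Zfun T criticalFugacity a b = ∑ n ∈ Finset.range T.card,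
      ∑ _ω ∈ (Zd.sawFun 2 n (b - a)).filter (fun ω => ∀ i ≤ n, a + ω i ∈ T), criticalFugacity ^ n :=
  rfl

/-- A self-avoiding walk with all its `n + 1` vertices in `T` has `n < |T|`. [folklore] -/
theorem lt_card_of_confined {T : Finset (Site 2)} {a b : Site 2} {n : ℕ} {ω : ℕ → Site 2}
    (hω : ω ∈ Zd.sawFun 2 n (b - a)) (hT : ∀ i ≤ n, a + ω i ∈ T) : n < T.card := by
  obtain ⟨-, -, -, hinj⟩ := Zd.mem_sawFun.1 hω
  have h : (Finset.range (n + 1)).card ≤ T.card := by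
    refine Finset.card_le_card_of_injOn (fun i => a + ω i) (fun i hi => ?_) ?_
    · rw [Finset.mem_coe, Finset.mem_range] at hi
      exact hT i (Nat.lt_succ_iff.1 hi)
    · intro i hi j hj hij
      rw [Finset.mem_coe, Finset.mem_range] at hi hj
      exact hinj (show i ≤ n by omega) (show j ≤ n by omega) (add_left_cancel hij)
  rw [Finset.card_range] at h
  omega

/-- The inner sums vanish from length `|T|` on. [folklore] -/
theorem inner_eq_zero_of_card_le {T : Finset (Site 2)} {a b : Site 2} {n : ℕ} (hn : T.card ≤ n) :
    (∑ _ω ∈ (Zd.sawFun 2 n (b - a)).filter (fun ω => ∀ i ≤ n, a + ω i ∈ T),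
      criticalFugacity ^ n) = 0 := by
  refine Finset.sum_eq_zero fun ω hω => ?_
  rw [Finset.mem_filter] at hω
  exact absurd (lt_card_of_confined hω.1 hω.2) (not_lt.2 hn)

/-- The inner sums are nonnegative. [folklore] -/
theorem inner_nonneg (T : Finset (Site 2)) (a b : Site 2) (n : ℕ) :
    0 ≤ ∑ _ω ∈ (Zd.sawFun 2 n (b - a)).filter (fun ω => ∀ i ≤ n, a + ω i ∈ T),
      criticalFugacity ^ n :=
  Finset.sum_nonneg fun _ _ => pow_nonneg criticalFugacity_pos.le n

/-- Every partial sum is below the full kernel (the terms of length `≥ |T|` vanish). [folklore] -/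
theorem partial_le_zfun (T : Finset (Site 2)) (a b : Site 2) (N : ℕ) :
    (∑ n ∈ Finset.range (N + 1), ∑ _ω ∈ (Zd.sawFun 2 n (b - a)).filter
        (fun ω => ∀ i ≤ n, a + ω i ∈ T), criticalFugacity ^ n) ≤ Zfun T criticalFugacity a b := by
  have hZ : Zfun T criticalFugacity a b = ∑ n ∈ Finset.range (max (N + 1) T.card),
      ∑ _ω ∈ (Zd.sawFun 2 n (b - a)).filter (fun ω => ∀ i ≤ n, a + ω i ∈ T),
        criticalFugacity ^ n := by
    rw [zfun_eq]
    refine Finset.sum_subset (Finset.range_subset_range.2 (le_max_right _ _)) fun n _ hn => ?_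
    rw [Finset.mem_range, not_lt] at hn
    exact inner_eq_zero_of_card_le hn
  rw [hZ]
  exact Finset.sum_le_sum_of_subset_of_nonneg (Finset.range_subset_range.2 (le_max_left _ _))
    fun n _ _ => inner_nonneg T a b n

/-- The full kernel is a partial sum once `|T| ≤ N + 1`. [folklore] -/
theorem zfun_le_partial (T : Finset (Site 2)) (a b : Site 2) {N : ℕ} (hN : T.card ≤ N + 1) :
    Zfun T criticalFugacity a b ≤ ∑ n ∈ Finset.range (N + 1), ∑ _ω ∈ (Zd.sawFun 2 n (b - a)).filter
        (fun ω => ∀ i ≤ n, a + ω i ∈ T), criticalFugacity ^ n :=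
  Finset.sum_le_sum_of_subset_of_nonneg (Finset.range_subset_range.2 hN) fun n _ _ => inner_nonneg T a b n

/-- Domain monotonicity: `T' ⊆ T → Z^{T'} ≤ Z^T`. [cite: MadrasSlade1993, §1.2] -/
theorem zfun_mono {T T' : Finset (Site 2)} (h : T' ⊆ T) (a b : Site 2) :
    Zfun T' criticalFugacity a b ≤ Zfun T criticalFugacity a b := by
  calc Zfun T' criticalFugacity a b
      ≤ ∑ n ∈ Finset.range T.card, ∑ _ω ∈ (Zd.sawFun 2 n (b - a)).filter
          (fun ω => ∀ i ≤ n, a + ω i ∈ T'), criticalFugacity ^ n :=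
        Finset.sum_le_sum_of_subset_of_nonneg (Finset.range_subset_range.2 (Finset.card_le_card h))
          fun n _ _ => inner_nonneg T' a b n
    _ ≤ Zfun T criticalFugacity a b := Finset.sum_le_sum fun n _ =>
        Finset.sum_le_sum_of_subset_of_nonneg (fun ω hω => by
            rw [Finset.mem_filter] at hω ⊢
            exact ⟨hω.1, fun i hi => h (hω.2 i hi)⟩)
          fun _ _ _ => pow_nonneg criticalFugacity_pos.le n

/-- A positive kernel forces its endpoint into the domain. [folklore] -/
theorem right_mem_of_zfun_pos {T : Finset (Site 2)} {a b : Site 2} (h : 0 < Zfun T criticalFugacity a b) :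
    b ∈ T := by
  by_contra hb
  have hz : Zfun T criticalFugacity a b = 0 := by
    refine Finset.sum_eq_zero fun n _ => Finset.sum_eq_zero fun ω hω => ?_
    exfalso
    rw [Finset.mem_filter] at hω
    obtain ⟨hω, hT⟩ := hω
    have hend := hT n le_rfl
    rw [(Zd.mem_sawFun.1 hω).2.1 n le_rfl, add_sub_cancel] at hend
    exact hb hend
  exact absurd hz h.ne'

/-- One confined self-avoiding walk of length `n` bounds the kernel below by `x_c^n`. [folklore] -/
theorem pow_le_zfun {T : Finset (Site 2)} {a b : Site 2} {n : ℕ} {ω : ℕ → Site 2}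
    (hω : ω ∈ Zd.sawFun 2 n (b - a)) (hT : ∀ i ≤ n, a + ω i ∈ T) :
    criticalFugacity ^ n ≤ Zfun T criticalFugacity a b := by
  have hn := lt_card_of_confined hω hT
  calc criticalFugacity ^ n
      ≤ ∑ _ω ∈ (Zd.sawFun 2 n (b - a)).filter (fun ω => ∀ i ≤ n, a + ω i ∈ T),
          criticalFugacity ^ n :=
        Finset.single_le_sum (f := fun _ => criticalFugacity ^ n)
          (fun _ _ => pow_nonneg criticalFugacity_pos.le n) (Finset.mem_filter.2 ⟨hω, hT⟩)
    _ ≤ Zfun T criticalFugacity a b := Finset.single_le_sum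
        (f := fun n => ∑ _ω ∈ (Zd.sawFun 2 n (b - a)).filter (fun ω => ∀ i ≤ n, a + ω i ∈ T),
          criticalFugacity ^ n) (fun n _ => inner_nonneg T a b n) (Finset.mem_range.2 hn)

/-! ### `ConvexMetricTriangle` at `x = x_c` -/

/-- `ConvexMetricTriangle` specialised to the critical fugacity: on the lattice trace `T` of a convex `K`,
`√(−log Z(a,c)) ≤ √(−log Z(a,b)) + √(−log Z(b,c))` whenever `Z(a,b), Z(b,c) > 0`.
[cite: BergChristensenRessel1984, Ch. 3 Prop. 3.2] -/
theorem cmt_zfun (hCMT : ConvexMetricTriangle) {K : Set ℂ} (hK : Convex ℝ K) {T : Finset (Site 2)}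
    (hT : ∀ z : Site 2, z ∈ T ↔ Site.toComplex z ∈ K) {a b c : Site 2} (ha : a ∈ T) (hb : b ∈ T)
    (hc : c ∈ T) (hab : 0 < Zfun T criticalFugacity a b) (hbc : 0 < Zfun T criticalFugacity b c) :
    Real.sqrt (-Real.log (Zfun T criticalFugacity a c)) ≤
      Real.sqrt (-Real.log (Zfun T criticalFugacity a b)) +
        Real.sqrt (-Real.log (Zfun T criticalFugacity b c)) :=
  hCMT K hK T hT criticalFugacity criticalFugacity_pos.le le_rfl a b c ha hb hc hab hbc

/-! ### Convex tubes -/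

/-- The tube `cthickening (ℓ/10 + 2) [u, v]` is convex (`Convex.cthickening` of a segment). [folklore] -/
theorem convex_tube (u v : Site 2) (ℓ : ℝ) :
    Convex ℝ (Metric.cthickening (ℓ / 10 + 2) (segment ℝ (Site.toComplex u) (Site.toComplex v))) :=
  (convex_segment _ _).cthickening _

/-- The segment is compact. [folklore] -/
theorem isCompact_segment_toComplex (u v : Site 2) :
    IsCompact (segment ℝ (Site.toComplex u) (Site.toComplex v)) := by
  rw [segment_eq_image]
  exact isCompact_Icc.image (by fun_prop)

/-- Membership in the tube is the distance test `infDist z [u,v] ≤ ℓ/10 + 2` (for `ℓ ≥ 0`). [folklore] -/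
theorem mem_tube_iff {u v : Site 2} {ℓ : ℝ} (hℓ : 0 ≤ ℓ) {z : ℂ} :
    z ∈ Metric.cthickening (ℓ / 10 + 2) (segment ℝ (Site.toComplex u) (Site.toComplex v)) ↔
      Metric.infDist z (segment ℝ (Site.toComplex u) (Site.toComplex v)) ≤ ℓ / 10 + 2 := by
  rw [Metric.mem_cthickening_iff, Metric.infDist,
    ENNReal.le_ofReal_iff_toReal_le (Metric.infEDist_ne_top ⟨_, left_mem_segment ℝ _ _⟩) (by linarith)]

/-- A coordinate of a lattice vector is bounded by the norm of its complex embedding. [folklore] -/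
theorem abs_coord_le_norm (z : Site 2) (i : Fin 2) : |((z i : ℤ) : ℝ)| ≤ ‖Site.toComplex z‖ := by
  fin_cases i
  · simpa [Site.toComplex] using Complex.abs_re_le_norm (Site.toComplex z)
  · simpa [Site.toComplex] using Complex.abs_im_le_norm (Site.toComplex z)

/-- **Finiteness of the trace.**  The lattice trace of the tube is a `Finset` `T` with the exact trace
condition `z ∈ T ↔ ↑z ∈ K(u,v,ℓ)` required by `ConvexMetricTriangle` (every point of the tube is within
`ℓ/10 + 2 + |u − v|` of `u`, hence in a translated box). [folklore] -/
theorem exists_tube_trace (u v : Site 2) {ℓ : ℝ} (hℓ : 0 ≤ ℓ) :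
    ∃ T : Finset (Site 2), ∀ z : Site 2, z ∈ T ↔
      Site.toComplex z ∈ Metric.cthickening (ℓ / 10 + 2) (segment ℝ (Site.toComplex u) (Site.toComplex v)) := by
  set R : ℝ := ℓ / 10 + 2 + dist (Site.toComplex u) (Site.toComplex v) with hR
  refine ⟨((box 2 ⌊R⌋₊).image (fun z => u + z)).filter (fun z => Site.toComplex z ∈
      Metric.cthickening (ℓ / 10 + 2) (segment ℝ (Site.toComplex u) (Site.toComplex v))), fun z => ?_⟩
  rw [Finset.mem_filter, Finset.mem_image]
  refine ⟨fun h => h.2, fun hz => ⟨⟨z - u, ?_, add_sub_cancel u z⟩, hz⟩⟩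
  have hd : dist (Site.toComplex z) (Site.toComplex u) ≤ R := by
    have hz' := (mem_tube_iff hℓ).1 hz
    obtain ⟨p, hp, hpd⟩ :=
      (isCompact_segment_toComplex u v).exists_infDist_eq_dist ⟨_, left_mem_segment ℝ _ _⟩ (Site.toComplex z)
    have hpu : dist p (Site.toComplex u) ≤ dist (Site.toComplex u) (Site.toComplex v) :=
      segment_subset_closedBall_left _ _ hp
    calc dist (Site.toComplex z) (Site.toComplex u)
        ≤ dist (Site.toComplex z) p + dist p (Site.toComplex u) := dist_triangle _ _ _
      _ ≤ R := by rw [← hpd, hR]; linarith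
  have hsub : Site.toComplex z - Site.toComplex u = Site.toComplex (z - u) :=
    Complex.ext (by simp [Site.toComplex]) (by simp [Site.toComplex])
  rw [Complex.dist_eq, hsub] at hd
  rw [mem_box]
  intro i
  have hfl : (((z - u) i).natAbs : ℝ) ≤ R := by
    rw [Nat.cast_natAbs, Int.cast_abs]
    exact (abs_coord_le_norm (z - u) i).trans hd
  have hn : ((z - u) i).natAbs ≤ ⌊R⌋₊ := Nat.le_floor hfl
  constructor <;> omega

/-- The trace condition in distance form. [folklore] -/
theorem trace_infDist {u v : Site 2} {ℓ : ℝ} (hℓ : 0 ≤ ℓ) {T : Finset (Site 2)}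
    (hT : ∀ z : Site 2, z ∈ T ↔
      Site.toComplex z ∈ Metric.cthickening (ℓ / 10 + 2) (segment ℝ (Site.toComplex u) (Site.toComplex v)))
    (z : Site 2) :
    z ∈ T ↔ Metric.infDist (Site.toComplex z) (segment ℝ (Site.toComplex u) (Site.toComplex v)) ≤ ℓ / 10 + 2 := by
  rw [hT z, mem_tube_iff hℓ]

/-- `u` lies in the trace of `K(u,v,ℓ)`. [folklore] -/
theorem left_mem_trace {u v : Site 2} {ℓ : ℝ} (hℓ : 0 ≤ ℓ) {T : Finset (Site 2)}
    (hT : ∀ z : Site 2, z ∈ T ↔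
      Site.toComplex z ∈ Metric.cthickening (ℓ / 10 + 2) (segment ℝ (Site.toComplex u) (Site.toComplex v))) :
    u ∈ T := by
  rw [trace_infDist hℓ hT, Metric.infDist_zero_of_mem (left_mem_segment ℝ _ _)]
  linarith

/-- `v` lies in the trace of `K(u,v,ℓ)`. [folklore] -/
theorem right_mem_trace {u v : Site 2} {ℓ : ℝ} (hℓ : 0 ≤ ℓ) {T : Finset (Site 2)}
    (hT : ∀ z : Site 2, z ∈ T ↔
      Site.toComplex z ∈ Metric.cthickening (ℓ / 10 + 2) (segment ℝ (Site.toComplex u) (Site.toComplex v))) :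
    v ∈ T := by
  rw [trace_infDist hℓ hT, Metric.infDist_zero_of_mem (right_mem_segment ℝ _ _)]
  linarith

/-- Distance to `[u, v]` is at most distance to `[w, v]` plus `|w − v|`. [folklore] -/
theorem infDist_segment_le (u v w : Site 2) (z : ℂ) :
    Metric.infDist z (segment ℝ (Site.toComplex u) (Site.toComplex v)) ≤
      Metric.infDist z (segment ℝ (Site.toComplex w) (Site.toComplex v)) +
        dist (Site.toComplex w) (Site.toComplex v) := by
  obtain ⟨p, hp, hpd⟩ :=
    (isCompact_segment_toComplex w v).exists_infDist_eq_dist ⟨_, left_mem_segment ℝ _ _⟩ z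
  have hpv : dist p (Site.toComplex v) ≤ dist (Site.toComplex w) (Site.toComplex v) :=
    segment_subset_closedBall_right _ _ hp
  calc Metric.infDist z (segment ℝ (Site.toComplex u) (Site.toComplex v))
      ≤ Metric.infDist p (segment ℝ (Site.toComplex u) (Site.toComplex v)) + dist z p :=
        Metric.infDist_le_infDist_add_dist
    _ ≤ dist p (Site.toComplex v) + dist z p := by
        gcongr
        exact Metric.infDist_le_dist_of_mem (right_mem_segment ℝ _ _)
    _ ≤ _ := by rw [← hpd]; linarith

/-- **Nesting of tubes.**  If `|w − v| ≤ ℓ'` and `11 ℓ' ≤ ℓ` (`ℓ' ≥ 0`), the trace of `K(w,v,ℓ')` lies in the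
trace of `K(u,v,ℓ)`: a point within `ℓ'/10 + 2` of `[w, v]` is within `ℓ'/10 + 2 + ℓ' ≤ ℓ/10 + 2` of
`[u, v] ∋ v`. [folklore] -/
theorem trace_subset {u v w : Site 2} {ℓ ℓ' : ℝ} (hℓ' : 0 ≤ ℓ')
    (hwv : dist (Site.toComplex w) (Site.toComplex v) ≤ ℓ') (h11 : 11 * ℓ' ≤ ℓ) {T T' : Finset (Site 2)}
    (hT : ∀ z : Site 2, z ∈ T ↔
      Site.toComplex z ∈ Metric.cthickening (ℓ / 10 + 2) (segment ℝ (Site.toComplex u) (Site.toComplex v)))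
    (hT' : ∀ z : Site 2, z ∈ T' ↔
      Site.toComplex z ∈ Metric.cthickening (ℓ' / 10 + 2) (segment ℝ (Site.toComplex w) (Site.toComplex v))) :
    T' ⊆ T := by
  intro z hz
  have hℓ : 0 ≤ ℓ := by linarith
  rw [trace_infDist hℓ' hT'] at hz
  rw [trace_infDist hℓ hT]
  have := infDist_segment_le u v w (Site.toComplex z)
  linarith

/-- Over the trace, the confinement predicate of `TubeLowerBound` is membership. [folklore] -/
theorem filter_tube_eq {u v : Site 2} {ℓ : ℝ} (hℓ : 0 ≤ ℓ) {T : Finset (Site 2)}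
    (hT : ∀ z : Site 2, z ∈ T ↔
      Site.toComplex z ∈ Metric.cthickening (ℓ / 10 + 2) (segment ℝ (Site.toComplex u) (Site.toComplex v)))
    (a e : Site 2) (n : ℕ) :
    (Zd.sawFun 2 n e).filter (fun ω => ∀ i ≤ n,
        Metric.infDist (Site.toComplex (a + ω i)) (segment ℝ (Site.toComplex u) (Site.toComplex v)) ≤
          ℓ / 10 + 2) =
      (Zd.sawFun 2 n e).filter (fun ω => ∀ i ≤ n, a + ω i ∈ T) := by
  refine Finset.filter_congr fun ω _ => ?_
  simp only [trace_infDist hℓ hT]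

/-! ### Lattice points of a ball -/

/-- The lattice points within distance `R ≥ 1` of a site form a `Finset` of cardinality `≤ 9 R²`. [folklore] -/
theorem exists_ball_finset (v : Site 2) {R : ℝ} (hR : 1 ≤ R) :
    ∃ B : Finset (Site 2), (∀ w : Site 2, w ∈ B ↔ dist (Site.toComplex w) (Site.toComplex v) ≤ R) ∧
      (B.card : ℝ) ≤ 9 * R ^ 2 := by
  refine ⟨((box 2 ⌊R⌋₊).image (fun z => v + z)).filter
      (fun w => dist (Site.toComplex w) (Site.toComplex v) ≤ R), fun w => ?_, ?_⟩
  · rw [Finset.mem_filter, Finset.mem_image]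
    refine ⟨fun h => h.2, fun hw => ⟨⟨w - v, ?_, add_sub_cancel v w⟩, hw⟩⟩
    have hsub : Site.toComplex w - Site.toComplex v = Site.toComplex (w - v) :=
      Complex.ext (by simp [Site.toComplex]) (by simp [Site.toComplex])
    rw [Complex.dist_eq, hsub] at hw
    rw [mem_box]
    intro i
    have hfl : (((w - v) i).natAbs : ℝ) ≤ R := by
      rw [Nat.cast_natAbs, Int.cast_abs]
      exact (abs_coord_le_norm (w - v) i).trans hw
    have hn : ((w - v) i).natAbs ≤ ⌊R⌋₊ := Nat.le_floor hfl
    constructor <;> omega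
  · have h1 : (((box 2 ⌊R⌋₊).image (fun z => v + z)).filter
        (fun w => dist (Site.toComplex w) (Site.toComplex v) ≤ R)).card ≤ (2 * ⌊R⌋₊ + 1) ^ 2 :=
      (Finset.card_filter_le _ _).trans (Finset.card_image_le.trans (card_box 2 _).le)
    have h2 : ((2 * ⌊R⌋₊ + 1 : ℕ) : ℝ) ≤ 3 * R := by
      have := Nat.floor_le (show 0 ≤ R by linarith)
      push_cast; linarith
    calc ((((box 2 ⌊R⌋₊).image (fun z => v + z)).filter
          (fun w => dist (Site.toComplex w) (Site.toComplex v) ≤ R)).card : ℝ)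
        ≤ ((2 * ⌊R⌋₊ + 1 : ℕ) : ℝ) ^ 2 := by exact_mod_cast h1
      _ ≤ (3 * R) ^ 2 := pow_le_pow_left₀ (by positivity) h2 2
      _ = 9 * R ^ 2 := by ring

end Summit.CriticalPhenomena.SAWScalingLimit.Theorems.ConvexMetricUpgrade

end
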